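import Literature.AlgebraicGeometry.Frobenioids.CharacteristicSplitting
import Literature.AlgebraicGeometry.Frobenioids.ElementaryIsomorphisms
import Literature.AlgebraicGeometry.Frobenioids.IsotropicFrobenioid
import HarnessLib

/-!
# Frobenioids I, proof of Proposition 2.5 (iii), step 1a: the characteristic splitting on every object

Mochizuki, *The geometry of Frobenioids I: the general theory*, Kyushu J. Math. **62** (2008)
293–400, §2, proof of Proposition 2.5 (iii), kurims text p. 49
[cite: MochizukiFrdI2008, Prop. 2.5(iii) p.49].

Standing data: a Frobenioid `F : C → F_Φ`, a characteristic splitting `τ` on `C` (Def. 2.3).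
The text (p. 49): "by applying the characteristic splitting `O^×(A) × τ(A) ⥲ O^▷(A)` [which applies
even if `A` is not isotropic — cf. Definition 2.3, (a), (b)] to `β ∈ O^▷(A)`, we obtain a
factorization `β = β₀ · β₁` [where `β₀ ∈ O^×(A)`, `β₁ ∈ τ(A)`]."

This file makes the bracket explicit for EVERY object `A`:
* `liftedTau τ A = τ'(A) ⊆ O^▷(A)`: the pull-back of `τ(A^istr)` along the inclusion
  `O^▷(A) ↪ O^▷(A^istr)` of Prop. 2.2 (iv) for the chosen isotropic hull `A → A^istr` (`hullHom`);
* for isotropic `A`, `τ'(A) = τ(A)` (`mem_liftedTau_iff_of_isIsotropic`);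
* the splitting `O^▷(A) = O^×(A) · τ'(A)` (`exists_liftedTau_split`, Def. 2.3 (a), (b) descended
  along the hull by Prop. 2.2 (iii)), `Div` injective on `τ'(A)` (`liftedTau_eq_of_div_eq`) and
  surjective onto `Φ(A)` for `A` metrically trivial and `Aut`-ample (`exists_liftedTau_div_eq`,
  Prop. 2.5 (i));
* `τ'` is a subfunctor along every linear arrow (`mem_liftedTau_of_intertwine`).
Composition is diagrammatic; `O^▷(A) ⊆ End A` multiplies by `f * g = g ≫ f` and is commutative
(Remark 1.3.1).
-/

noncomputable section

namespace Literature.AlgebraicGeometry.Frobenioids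

open CategoryTheory Opposite

universe w v v' u u'

namespace PreFrobenioid

variable {D : Type u} [Category.{v} D] {Φ : Dᵒᵖ ⥤ CommMonCat.{w}}
  {C : Type u'} [Category.{v'} C] {F : C ⥤ ElemFrobenioid Φ}

/-! ### Preliminaries: intertwiners, divisors, hulls -/

/-- Divisors of intertwined elements: if `φ : X → Y` is linear and `φ ; β = α ; φ` with
`α ∈ O^▷(X)`, `β ∈ O^▷(Y)`, then `Div(α) = φ^* Div(β)` (Remark 1.1.1 and cancellation in the
integral monoid `Φ(X)`). [cite: MochizukiFrdI2008, Prop. 2.2(iii) p.45] -/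
theorem div_eq_pull_div_of_intertwine (hF : IsFrobenioid F) {X Y : C} {φ : X ⟶ Y}
    (hφ : IsLinear F φ) {β : endSubmonoid F Y} {α : endSubmonoid F X}
    (h : φ ≫ (β.1 : Y ⟶ Y) = (α.1 : X ⟶ X) ≫ φ) :
    divHom F X α = pull Φ (Base F φ) (divHom F Y β) := by
  have hd := congrArg (Div F) h
  rw [div_comp, div_comp, show degFr F (β.1 : Y ⟶ Y) = 1 from β.2.2,
    show Base F (α.1 : X ⟶ X) = 𝟙 _ from α.2.1, pull_id, show degFr F φ = 1 from hφ,
    PNat.one_coe, pow_one, pow_one, mul_comm] at hd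
  haveI : IsCancelMul (Φ.obj (op (baseObj F X))) :=
    isIntegral_iff_isCancelMul.mp (hF.isPreFrobenioid.isDivisorial (baseObj F X)).isPreDivisorial.isIntegral
  exact (mul_left_cancel hd).symm

/-- Divisors along an isotropic hull: `Base(h)^* Div(O^▷(h)(a)) = Div(a)` for the inclusion
`O^▷(h) : O^▷(A) ↪ O^▷(A^istr)` of Prop. 2.2 (iv). [cite: MochizukiFrdI2008, Prop. 2.2(iv) p.45] -/
theorem pull_div_hullMap (hF : IsFrobenioid F) {A B : C} {h : A ⟶ B} (hh : IsIsotropicHull F h)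
    (a : endSubmonoid F A) :
    pull Φ (Base F h) (divHom F B (hullMap hh a)) = divHom F A a :=
  (div_eq_pull_div_of_intertwine hF hh.2.1.1 (hullMap_spec hh a)).symm

/-- In `O^▷(X)`, `u · t = u' · t` implies `u = u'` (`t` is an epimorphism of `C`).
[cite: MochizukiFrdI2008, Prop. 2.5(iii) p.49] -/
theorem endSubmonoid_mul_right_cancel (hF : IsFrobenioid F) {X : C} {u u' t : endSubmonoid F X}
    (h : u * t = u' * t) : u = u' := by
  haveI := hF.isPreFrobenioid.isTotallyEpimorphic.epi (t.1 : X ⟶ X)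
  have h' : (t.1 : X ⟶ X) ≫ (u.1 : X ⟶ X) = (t.1 : X ⟶ X) ≫ (u'.1 : X ⟶ X) :=
    congrArg (fun x : endSubmonoid F X => (x.1 : X ⟶ X)) h
  exact Subtype.ext ((cancel_epi (t.1 : X ⟶ X)).mp h')

/-- The chosen isotropic hull of an isotropic object is an isomorphism (an isometric pre-step out
of an isotropic object). [cite: MochizukiFrdI2008, Def. 1.2(iv) p.23] -/
theorem isIso_hullHom_of_isIsotropic (hF : IsFrobenioid F) {Y : C} (hY : IsIsotropic F Y) :
    IsIso (hullHom hF Y) :=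
  hY (hullHom hF Y) (isIsotropicHull_hullHom hF Y).1 (isIsotropicHull_hullHom hF Y).2.1

/-- Functoriality of chosen hulls on arrows: every `f : X → Y` extends uniquely to
`f^istr : X^istr → Y^istr` with `h_X ; f^istr = f ; h_Y`, of the same Frobenius degree.
[cite: MochizukiFrdI2008, Prop. 1.9(v) p.33] -/
theorem exists_hull_square (hF : IsFrobenioid F) {X Y : C} (f : X ⟶ Y) :
    ∃ g : hullObj hF X ⟶ hullObj hF Y, hullHom hF X ≫ g = f ≫ hullHom hF Y ∧
      degFr F g = degFr F f := by
  have hhX := isIsotropicHull_hullHom hF X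
  have hhY := isIsotropicHull_hullHom hF Y
  obtain ⟨g, hg, -⟩ := hhX.2.2.2 (f ≫ hullHom hF Y) hhY.2.2.1
  refine ⟨g, hg, ?_⟩
  have hd := congrArg (degFr F) hg
  rw [degFr_comp, degFr_comp, show degFr F (hullHom hF X) = 1 from hhX.2.1.1,
    show degFr F (hullHom hF Y) = 1 from hhY.2.1.1, one_mul, mul_one] at hd
  exact hd

namespace CharacteristicSplitting

variable (hF : IsFrobenioid F) (τ : CharacteristicSplitting F)

/-! ### `τ'(A)`: the characteristic splitting pulled back along the chosen isotropic hull -/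

/-- `τ'(A) ⊆ O^▷(A)`: the elements whose image under `O^▷(A) ↪ O^▷(A^istr)` (Prop. 2.2 (iv), for the
chosen isotropic hull `A → A^istr`) lies in `τ(A^istr)` — the splitting "applies even if `A` is not
isotropic — cf. Definition 2.3, (a), (b)". [cite: MochizukiFrdI2008, Prop. 2.5(iii) p.49] -/
def liftedTau (A : C) : Submonoid (endSubmonoid F A) where
  carrier := {a | ((hullMap (isIsotropicHull_hullHom hF A) a).1 : End (hullObj hF A)) ∈
    τ.τ (hullObj hF A)}
  one_mem' := by
    show ((hullMap (isIsotropicHull_hullHom hF A) 1).1 : End (hullObj hF A)) ∈ τ.τ (hullObj hF A)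
    rw [map_one]
    exact one_mem _
  mul_mem' {a b} ha hb := by
    show ((hullMap (isIsotropicHull_hullHom hF A) (a * b)).1 : End (hullObj hF A)) ∈
      τ.τ (hullObj hF A)
    rw [map_mul]
    exact mul_mem ha hb

variable {hF τ} in
/-- Membership in `τ'(A)`. [cite: MochizukiFrdI2008, Prop. 2.5(iii) p.49] -/
theorem mem_liftedTau_iff {A : C} (a : endSubmonoid F A) :
    a ∈ liftedTau hF τ A ↔
      ((hullMap (isIsotropicHull_hullHom hF A) a).1 : End (hullObj hF A)) ∈ τ.τ (hullObj hF A) :=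
  Iff.rfl

/-- For an isotropic `Y`, `τ'(Y) = τ(Y)` (the chosen hull `Y → Y^istr` is a linear isomorphism of
`C^istr`, and `τ` is a subfunctor along it and along its inverse, Def. 2.3).
[cite: MochizukiFrdI2008, Def. 2.3 p.47] -/
theorem mem_liftedTau_iff_of_isIsotropic {Y : C} (hY : IsIsotropic F Y) (s : endSubmonoid F Y) :
    s ∈ liftedTau hF τ Y ↔ (s.1 : End Y) ∈ τ.τ Y := by
  have hh := isIsotropicHull_hullHom hF Y
  haveI := isIso_hullHom_of_isIsotropic hF hY
  have hsq := hullMap_spec hh s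
  dsimp only at hsq
  constructor
  · intro hs
    exact τ.res_mem hY hh.2.2.1 (hullHom hF Y) hh.2.1.1 _ hs s.1 s.2 hsq
  · intro hs
    refine τ.res_mem hh.2.2.1 hY (inv (hullHom hF Y)) (isLinear_of_isIso F _) s.1 hs
      (hullMap hh s).1 (hullMap hh s).2 ?_
    rw [IsIso.inv_comp_eq, ← Category.assoc, hsq, Category.assoc, IsIso.hom_inv_id,
      Category.comp_id]

/-- `Div` is injective on `τ'(A)`: elements of `τ'(A)` with the same divisor are associated
(Prop. 2.2 (iii)), hence have associated images in `τ(A^istr)`, which are then equal by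
Def. 2.3 (a); and `O^▷(A) ↪ O^▷(A^istr)` is injective (Prop. 2.2 (iv)).
[cite: MochizukiFrdI2008, Prop. 2.5(iii) p.49] -/
theorem liftedTau_eq_of_div_eq {A : C} {t t' : endSubmonoid F A} (ht : t ∈ liftedTau hF τ A)
    (ht' : t' ∈ liftedTau hF τ A) (h : divHom F A t = divHom F A t') : t = t' := by
  have hh := isIsotropicHull_hullHom hF A
  haveI : IsIso (Base F (hullHom hF A)) := hh.2.1.2
  apply hullMap_injective hh hF
  have hdiv : divHom F _ (hullMap hh t) = divHom F _ (hullMap hh t') := by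
    apply pull_injective_of_isIso Φ (Base F (hullHom hF A))
    rw [pull_div_hullMap hF hh, pull_div_hullMap hF hh, h]
  have hassoc : Associated (hullMap hh t) (hullMap hh t') :=
    (div_eq_div_iff_associated F hF _ _).mp hdiv
  have key := (τ.bijective hh.2.2.1).1
    (a₁ := ⟨(hullMap hh t).1, ht⟩) (a₂ := ⟨(hullMap hh t').1, ht'⟩)
    (Associates.mk_eq_mk_iff_associated.mpr hassoc)
  exact Subtype.ext (congrArg (fun x : τ.τ (hullObj hF A) => (x.1 : End (hullObj hF A))) key)

/-- **The splitting `O^▷(A) = O^×(A) · τ'(A)`** for every object `A` (Def. 2.3 (a) on `A^istr`,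
descended along `O^▷(A) ↪ O^▷(A^istr)` by Def. 2.3 (b) and Prop. 2.2 (iii)): every `β ∈ O^▷(A)` is
`β = β₀ · β₁` with `β₀ ∈ O^▷(A)^×` and `β₁ ∈ τ'(A)`. [cite: MochizukiFrdI2008, Prop. 2.5(iii) p.49] -/
theorem exists_liftedTau_split {A : C} (β : endSubmonoid F A) :
    ∃ t ∈ liftedTau hF τ A, ∃ u : endSubmonoid F A, IsUnit u ∧ β = u * t := by
  have hh := isIsotropicHull_hullHom hF A
  have hP := hF.isPreFrobenioid
  -- split the image of `β` in `O^▷(A^istr)` and descend the `τ`-component along the hull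
  obtain ⟨s, hs⟩ := (τ.bijective hh.2.2.1).2 (Associates.mk (hullMap hh β))
  obtain ⟨a, ha, hsq⟩ := τ.hull (hullHom hF A) hh s.1 s.2
  let t : endSubmonoid F A := ⟨a, ha⟩
  have ht : (hullMap hh t).1 = s.1 := by
    show hullLift hh a = s.1
    exact (hullLift_unique hh a s.1 hsq).symm
  have htmem : t ∈ liftedTau hF τ A := by
    rw [mem_liftedTau_iff, ht]; exact s.2
  -- `t` and `β` have the same divisor, hence are associated
  have hassoc : Associated (hullMap hh t) (hullMap hh β) := by
    apply Associates.mk_eq_mk_iff_associated.mp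
    rw [← hs]
    congr 1
    exact Subtype.ext ht
  have hdiv : divHom F A t = divHom F A β := by
    rw [← pull_div_hullMap hF hh t, ← pull_div_hullMap hF hh β, divHom_eq_of_associated F hP hassoc]
  obtain ⟨w, hw⟩ := (div_eq_div_iff_associated F hF t β).mp hdiv
  refine ⟨t, htmem, (w : endSubmonoid F A), w.isUnit, ?_⟩
  rw [← hw]
  exact endSubmonoid_comm F hF t ↑w

/-- `Div : τ'(A) → Φ(A)` is surjective for `A` metrically trivial and `Aut`-ample (Prop. 2.5 (i)
and the splitting). [cite: MochizukiFrdI2008, Prop. 2.5(i) p.48] -/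
theorem exists_liftedTau_div_eq {A : C} (hmt : IsMetricallyTrivial F A) (haa : IsAutAmple F A)
    (x : Φ.obj (op (baseObj F A))) : ∃ t ∈ liftedTau hF τ A, divHom F A t = x := by
  obtain ⟨q, hq⟩ := charDiv_surjective F hF hmt haa x
  obtain ⟨e, rfl⟩ := Associates.mk_surjective q
  rw [charDiv_mk] at hq
  obtain ⟨t, ht, u, hu, hut⟩ := exists_liftedTau_split hF τ e
  refine ⟨t, ht, ?_⟩
  rw [← hq, hut, map_mul, divHom_eq_one_of_isUnit F hF.isPreFrobenioid hu, one_mul]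

/-! ### `τ'` is a subfunctor -/

/-- `τ'` is a subfunctor: if `φ : X → Y` is ANY arrow, `t ∈ τ'(Y)` and `t' ∈ O^▷(X)` with
`φ ; t = t' ; φ`, then `t' ∈ τ'(X)` (apply Def. 2.3 "subfunctor" to `φ^istr : X^istr → Y^istr`).
[cite: MochizukiFrdI2008, Def. 2.3 p.47] -/
theorem mem_liftedTau_of_intertwine {X Y : C} {φ : X ⟶ Y} (hφ : IsLinear F φ)
    {t : endSubmonoid F Y} (ht : t ∈ liftedTau hF τ Y) {t' : endSubmonoid F X}
    (h : φ ≫ (t.1 : Y ⟶ Y) = (t'.1 : X ⟶ X) ≫ φ) : t' ∈ liftedTau hF τ X := by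
  have hhX := isIsotropicHull_hullHom hF X
  have hhY := isIsotropicHull_hullHom hF Y
  obtain ⟨g, hg, hgd⟩ := exists_hull_square hF φ
  have hglin : IsLinear F g := by show degFr F g = 1; rw [hgd]; exact hφ
  rw [mem_liftedTau_iff]
  refine τ.res_mem hhX.2.2.1 hhY.2.2.1 g hglin _ ht _ (hullMap hhX t').2 ?_
  haveI := hF.isPreFrobenioid.isTotallyEpimorphic.epi (hullHom hF X)
  rw [← cancel_epi (hullHom hF X), ← Category.assoc, hg, Category.assoc, hullMap_spec hhY t,
    ← Category.assoc, h, Category.assoc, ← hg, ← Category.assoc, ← hullMap_spec hhX t',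
    Category.assoc]

end CharacteristicSplitting

end PreFrobenioid

end Literature.AlgebraicGeometry.Frobenioids
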